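import Summits.QuantumFields.BalabanUV.T4Continuum.Support.NE9Contraction113Banach
import Summits.QuantumFields.BalabanUV.T4Continuum.Support.NE9Prop6SchemeBanach
import Summits.QuantumFields.BalabanUV.T4Continuum.Support.NE9ComplexBackgroundOfContraction

/-!
# NE9SectGChartAssembly — B11 Sect. G's CHART MAP 𝓗(B) OF (174) ASSEMBLED FROM THE TWO ANALYTIC SOLUTION MAPS: analytic on the
# B-ball, 𝓗(0) = 0, D𝓗(0) = H₁ ((177)'s first-order term), with 𝒜₁ beginning at second order ((176)) — route R2′ «`cur` BY THREE
# DISPLAYED CONTRACTIONS» of `t4/ROUTES-NE9.md` v2 §L1.2, the ASSEMBLY step over ABSTRACT carriers (what step B2′ — socket C19′,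
# FROZEN under ruling e34b3e0c (0) — must instantiate); cell `pub-balaban`, T4-DAG §2 node U3 ∕ §6 NE9; unit
# `b2b-balaban-t4-ne9-formalise-leaf-03`, generation 38; Summits-side NEW work, nothing printed asserted)

HONEST FRAMING (T4-DAG PAGE 1).  Rung (B)+1 of the FINITE-VOLUME T⁴ programme — NOT infinite volume, NOT a mass gap, NOT
the Clay problem.  NE9 (`T4OutputRate.NE9` ∧ `FadingMemory`) is a cell NEW ESTIMATE, NOT PRINTED in [I] = CMP **109**, [II] =
CMP **116**, and NOT PROVED here («NE9 ⇐ the named binders»; spine PROVED 0∕9).  HONEST DEPENDENCY (cell line, verbatim):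
continuum YM on T⁴ ⇐ BetaPertH ∧ nine spine estimates (0/9 proved); BetaPertH ⇐ (D1) ∧ (D4) ∧ CAP+tail; G-an2-4 gates asym,
D1 and NE2/3/4.  MECHANISM ONLY: the carriers `𝒳, 𝒴, 𝒵, 𝒲`, the functional `C` of (49), the operators `H`, `𝔊`, `H₁`, the
derivative `W = (δ∕δA′)V` and every smallness letter are ABSTRACT ∕ HYPOTHESES; NOTHING of Bałaban's is constructed and no inequality
of the series is proved.  What is kernel is the COMPOSITION LOGIC of [15] Sect. G p. 305 (174)–(175) and the two expansion
statements p. 306 (176)–(177), over the tree's typings `B13Contraction113` (Sect. C's contraction, = [II] (1.13)) and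
`B11Prop6Scheme.mapT` (Prop. 6's), whose jointly-analytic solution maps are `NE9Contraction113Banach` ∕ `NE9Prop6SchemeBanach`.

THE PRINT (render-read for this leaf, [15] pp. 305–307 = PDF 29–31, images; recorded in the cell journal).  p. 305: (172) *"|V′ − 1| <
C₁ε₁, hence V′ = e^{iB′}, |B′| < 2C₁ε₁ on 𝔅_k"*; *"U₁ = exp iη𝓗(B), 𝓗 satisfies the conditions (19)–(21) with ε₂ = … ≤ 6B₁B₃C₁ε₁ =
B₅ε₁. (173) … The configuration 𝓗 is represented as 𝓗 = 𝒜₁ + H₁B − HD(𝒜₁ + H₁B), (174) where 𝒜₁ satisfies the equation 𝒜₁ +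
𝔊((δ∕δA′)V)(𝒜₁ + H₁B) = 0, (175) and the regularity conditions (19) with ε₂ = 8B₅ε₁. The function on the right-hand side of (174) is
an analytic function of 𝒜₁ + H₁B, and we have discussed its expansion in Sect. C."*; p. 306: *"The function 𝒜₁, as a solution of
Eq. (175), is an analytic function of H₁B, hence of B. … it begins with a term of second order in H₁B, more exactly we have 𝒜₁^{(2)} =
−𝔊((δ∕δA′)V^{(3)})(H₁B). (176) This implies that the expansion of 𝓗 begins with the first order term H₁B"* (177); p. 307:
*"Independently of the representation chosen, the function 𝓗(B) is an analytic function of 𝔤^c-valued configurations B defined on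
𝔅_k and satisfying (172)."*  (175) is `B11Prop6Scheme.mapT 𝔊 0 W 0 (H₁B)` (`mapT_158` form); D is Sect. C's solution of (49)
`D = C(A′ − H D)` (`B13Contraction113`, (C₂, b, ε) letters); (174) has the shape of the tree's `B11.LGData.T47 U₀ A′ = A′ − HD(A′)`.

WHAT THIS LEAF PROVES (kernel; [folklore] composition over abstract complex Banach spaces).
(§1) `norm_le_mul_sq_of_mapT_zero` — (176) as an inequality: a solution `X = −𝔊 W(X + 𝔄)` with `‖X‖ ≤ ε₄`, `‖𝔄‖ < a`,
`ε₄ + a ≤ a₃`, `4B₀C₄ε₄ ≤ 1` obeys `‖X‖ ≤ 4B₀C₄‖𝔄‖²` (*"begins with a term of second order in H₁B"*).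
(§2) `exists_sectG_chart` — THE ASSEMBLY: under Sect. C's letters (`9C₂bε < 1`, `3ε ≤ R`), Prop. 6's letters with `J = 0`, `Λ = 0`
(`2(ε₄ + a) ≤ a₃`, `B₀C₄(ε₄ + a)² ≤ ε₄`, `4B₀C₄(ε₄ + a) < 1`) and the two LINKING letters `‖H₁‖·ρ ≤ a` (H₁B stays in the (175)-data
ball for `‖B‖ < ρ`, the role of (172)–(173)) and `ε₄ + a ≤ ε` (𝒜₁ + H₁B stays in Sect. C's ball, the role of «(19) with ε₂ = 8B₅ε₁»),
there are `𝒜₁ : 𝒴 → 𝒴` (analytic on `‖𝔄‖ < a`, the unique solution of (175) in `‖·‖ ≤ ε₄`, `‖𝒜₁ 𝔄‖ ≤ 4B₀C₄‖𝔄‖²`), `D : 𝒴 → 𝒳`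
(analytic on `‖A′‖ < ε`, the unique solution of (49) in `‖·‖ ≤ 4C₂ε²`, `‖D A′‖ ≤ 4C₂‖A′‖²`) and `𝓗 : 𝒲 → 𝒴` with
`𝓗 B = (𝒜₁(H₁B) + H₁B) − H(D(𝒜₁(H₁B) + H₁B))` ((174) LITERALLY), `AnalyticOnNhd ℂ 𝓗 (ball 0 ρ)`, `𝓗 0 = 0`, `HasFDerivAt 𝓗 H₁ 0`.
(§3) `exists_chartFamily_of_sectG` — THE SUBSTRATE READING: with `𝒴 := TowerData P o` (the substrate's finite-dimensional chart space) the
assembled `𝓗` INHABITS `SubstrateComplexBackground.ComplexBackgroundFamily P 𝒲 R0 ρ` ON THE PRESCRIBED `ρ` through `ofChart`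
(`uC B = expChartT P R0 (𝓗 B)`), with `𝓗 0 = 0`, `HasFDerivAt 𝓗 H₁ 0` and (174)'s clauses — the R2′ analogue, for the ASSEMBLED chart,
of generation 37's `NE9ComplexBackgroundOfContraction.exists_chartFamily_of_contraction` (one contraction); p. 307's gauge return
(*"an analytic function of 𝓗, hence of B"*) is one more analytic composite and is NOT typed here.  HONEST CAVEAT (typing): `C`, `W` Fréchet-analytic as in the two
companions; the alternative representation (179)–(180) (𝒜₀, H₀, Λ = G̃Δ^{(2)} or J = −Δ^{(2)}H₀B) is covered by `NE9Prop6SchemeBanach`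
but not assembled here (its first-order term is (G̃Δ^{(2)} + 1)H₀, not second-order-free).  DISGUISE TEST: composition of analytic maps,
the chain rule, §1's arithmetic; no inequality of the series; not NE9; 0 def, 0 sorry.

References (TYPES ∕ loci only): [Balaban1985Variational] T. Bałaban, CMP **102** (1985) 277–309, Sect. C (49)–(56) pp. 285–287,
Sect. E Prop. 6 (111)–(121) pp. 294–296, Sect. G (171)–(181) pp. 305–307; [Balaban1988RG2Cluster] CMP **116** (1988) p. 5 (1.12)–(1.14);
[Balaban1987RG1] CMP **109** (1987) (3.26)–(3.27), Lemma 4 (3.53) p. 280 (where the cell reads the chart H_{k+1}(□₀,B); iface-1: «no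
taker»).  Imports `NE9Contraction113Banach` + `NE9Prop6SchemeBanach` + `NE9ComplexBackgroundOfContraction` ONLY; modifies nothing.  Value = route-R2′ assembly, NOT summit
progress.
-/

noncomputable section

open scoped Topology NNReal
open Metric Set Filter Function

namespace Summit.QuantumFields.BalabanUV.T4Continuum.NE9SectGChartAssembly

open Literature.MathematicalPhysics.QuantumFieldTheory.Balaban1983to89.B11Prop6Scheme (mapT mapT_158)
open Summit.QuantumFields.BalabanUV.T4Continuum.NE9Contraction113Banach
open Summit.QuantumFields.BalabanUV.T4Continuum.NE9Prop6SchemeBanach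

/-! ## §1 (176) as an inequality: the solution of (175) begins at second order in its datum -/

section SecondOrder

variable {𝒴 𝒵 : Type*} [NormedAddCommGroup 𝒴] [NormedSpace ℂ 𝒴] [NormedAddCommGroup 𝒵] [NormedSpace ℂ 𝒵]

/-- [folklore arithmetic on the printed scheme] **The solution of (175) is `O(‖𝔄‖²)`** (p. 306 (176): *"it begins with a term of
second order in H₁B"*): if `X = mapT 𝔊 0 W 0 𝔄 X = −𝔊(W(X + 𝔄))` with `‖𝔊 f‖ ≤ B₀‖f‖`, `‖W Y‖ ≤ C₄‖Y‖²` on `‖Y‖ < a₃`, `‖X‖ ≤ ε₄`,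
`‖𝔄‖ < a`, `ε₄ + a ≤ a₃` and `4B₀C₄ε₄ ≤ 1`, then `‖X‖ ≤ 4B₀C₄‖𝔄‖²` (from `‖X‖ ≤ B₀C₄(‖X‖ + ‖𝔄‖)² ≤ 2B₀C₄ε₄‖X‖ + 2B₀C₄‖𝔄‖²`). -/
theorem norm_le_mul_sq_of_mapT_zero {𝔊 : 𝒵 →L[ℂ] 𝒴} {W : 𝒴 → 𝒵} {B₀ C₄ a₃ a ε₄ : ℝ}
    (h𝔊 : ∀ f, ‖𝔊 f‖ ≤ B₀ * ‖f‖) (hWq : ∀ Y : 𝒴, ‖Y‖ < a₃ → ‖W Y‖ ≤ C₄ * ‖Y‖ ^ 2) (hB₀ : 0 ≤ B₀) (hC₄ : 0 ≤ C₄)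
    (hdom : ε₄ + a ≤ a₃) (hsmall : 4 * B₀ * C₄ * ε₄ ≤ 1)
    {𝔄 X : 𝒴} (h𝔄 : ‖𝔄‖ < a) (hX : ‖X‖ ≤ ε₄) (hfix : mapT 𝔊 0 W 0 𝔄 X = X) :
    ‖X‖ ≤ 4 * B₀ * C₄ * ‖𝔄‖ ^ 2 := by
  have harg : ‖X + 𝔄‖ < a₃ := (norm_add_le X 𝔄).trans_lt (by linarith)
  have h1 : ‖X‖ ≤ B₀ * C₄ * ‖X + 𝔄‖ ^ 2 := by
    have e : X = -𝔊 (W (X + 𝔄)) := by rw [← mapT_158 𝔊 W 𝔄 X]; exact hfix.symm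
    calc ‖X‖ = ‖-𝔊 (W (X + 𝔄))‖ := by rw [← e]
      _ = ‖𝔊 (W (X + 𝔄))‖ := norm_neg _
      _ ≤ B₀ * ‖W (X + 𝔄)‖ := h𝔊 _
      _ ≤ B₀ * (C₄ * ‖X + 𝔄‖ ^ 2) := mul_le_mul_of_nonneg_left (hWq _ harg) hB₀
      _ = B₀ * C₄ * ‖X + 𝔄‖ ^ 2 := by ring
  have h2 : ‖X + 𝔄‖ ^ 2 ≤ 2 * ‖X‖ ^ 2 + 2 * ‖𝔄‖ ^ 2 := by
    have := norm_add_le X 𝔄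
    nlinarith [sq_nonneg (‖X‖ - ‖𝔄‖), norm_nonneg (X + 𝔄), norm_nonneg X, norm_nonneg 𝔄]
  have hBC : 0 ≤ B₀ * C₄ := mul_nonneg hB₀ hC₄
  have h3 : ‖X‖ ≤ 2 * (B₀ * C₄) * ε₄ * ‖X‖ + 2 * (B₀ * C₄) * ‖𝔄‖ ^ 2 := by
    have hXX : ‖X‖ ^ 2 ≤ ε₄ * ‖X‖ := by
      rw [sq]; exact mul_le_mul_of_nonneg_right hX (norm_nonneg X)
    nlinarith [h1, h2, hXX, hBC]
  have h4 : 2 * (B₀ * C₄) * ε₄ ≤ 1 / 2 := by linarith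
  nlinarith [h3, h4, norm_nonneg X, mul_nonneg hBC (sq_nonneg ‖𝔄‖)]

end SecondOrder

/-! ## §2 The assembly (174): 𝓗(B) = (𝒜₁(H₁B) + H₁B) − H·D(𝒜₁(H₁B) + H₁B) -/

section Assembly

variable {𝒳 𝒴 𝒵 𝒲 : Type*} [NormedAddCommGroup 𝒳] [NormedSpace ℂ 𝒳] [CompleteSpace 𝒳]
  [NormedAddCommGroup 𝒴] [NormedSpace ℂ 𝒴] [CompleteSpace 𝒴]
  [NormedAddCommGroup 𝒵] [NormedSpace ℂ 𝒵] [NormedAddCommGroup 𝒲] [NormedSpace ℂ 𝒲]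

omit [CompleteSpace 𝒴] in
/-- [folklore] `‖H₁ B‖ < a` on the open ball `‖B‖ < ρ` when `‖H₁‖·ρ ≤ a` and `0 < a` (the role of (172)–(173): B small ⇒ H₁B is an
admissible datum for (175)). -/
theorem norm_apply_lt_of_opNorm_mul_le {H₁ : 𝒲 →L[ℂ] 𝒴} {ρ a : ℝ} (ha : 0 < a) (hρa : ‖H₁‖ * ρ ≤ a)
    {B : 𝒲} (hB : B ∈ ball (0:𝒲) ρ) : ‖H₁ B‖ < a := by
  have hBρ : ‖B‖ < ρ := mem_ball_zero_iff.mp hB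
  rcases (norm_nonneg H₁).eq_or_lt with h0 | hpos
  · calc ‖H₁ B‖ ≤ ‖H₁‖ * ‖B‖ := H₁.le_opNorm B
      _ = 0 := by rw [← h0, zero_mul]
      _ < a := ha
  · calc ‖H₁ B‖ ≤ ‖H₁‖ * ‖B‖ := H₁.le_opNorm B
      _ < ‖H₁‖ * ρ := mul_lt_mul_of_pos_left hBρ hpos
      _ ≤ a := hρa

/-- [folklore] **B11 Sect. G's CHART MAP (174), ASSEMBLED.**  Data: Sect. C's functional `C : 𝒴 → 𝒳` (`‖C Y‖ ≤ C₂‖Y‖²` and analytic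
on `‖Y‖ < R`) and operator `H : 𝒳 →L[ℂ] 𝒴` (`‖H‖ ≤ b`), letters `0 < ε`, `9C₂bε < 1`, `3ε ≤ R` ((49)–(55)); Prop. 6's operator
`𝔊 : 𝒵 →L[ℂ] 𝒴` (`‖𝔊 f‖ ≤ B₀‖f‖`) and derivative `W = (δ∕δA′)V : 𝒴 → 𝒵` (`‖W Y‖ ≤ C₄‖Y‖²` and analytic on `‖Y‖ < a₃`, Prop. 4),
letters `0 < a`, `0 ≤ ε₄`, `2(ε₄ + a) ≤ a₃`, `B₀C₄(ε₄ + a)² ≤ ε₄`, `4B₀C₄(ε₄ + a) < 1` ((118) ∕ (120)–(121) with `J = 0`, `Λ = 0`, i.e.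
(175) = (158)-form); the linear map `H₁ : 𝒲 →L[ℂ] 𝒴` and a B-radius `ρ` with `‖H₁‖·ρ ≤ a` and `ε₄ + a ≤ ε`.  Conclusion: there are
`𝒜₁`, `D`, `𝓗` with — (175): for `‖𝔄‖ < a`, `𝒜₁ 𝔄` is THE solution of `mapT 𝔊 0 W 0 𝔄 X = X` in `‖X‖ ≤ ε₄`, `‖𝒜₁ 𝔄‖ ≤ 4B₀C₄‖𝔄‖²`
((176)), `𝒜₁` analytic there (p. 306); (49): for `‖A′‖ < ε`, `D A′` is THE solution of `C(A′ − H X) = X` in `‖X‖ ≤ 4C₂ε²`,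
`‖D A′‖ ≤ 4C₂‖A′‖²` ((55)), `D` analytic there (p. 286); (174): `𝓗 B = (𝒜₁(H₁B) + H₁B) − H(D(𝒜₁(H₁B) + H₁B))` for all `B`, `𝓗`
ANALYTIC on `‖B‖ < ρ` (p. 307), `𝓗 0 = 0`, and `HasFDerivAt 𝓗 H₁ 0` ((177): *"the expansion of 𝓗 begins with the first order term
H₁B"*). -/
theorem exists_sectG_chart {C : 𝒴 → 𝒳} {C₂ R b ε : ℝ} {H : 𝒳 →L[ℂ] 𝒴}
    (hquad : ∀ Y : 𝒴, ‖Y‖ < R → ‖C Y‖ ≤ C₂ * ‖Y‖ ^ 2) (hCa : AnalyticOnNhd ℂ C (ball (0:𝒴) R))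
    (hC₂ : 0 ≤ C₂) (hb : 0 ≤ b) (hHb : ‖H‖ ≤ b) (hε : 0 < ε) (hq : 9 * C₂ * b * ε < 1) (hRC : 3 * ε ≤ R)
    {𝔊 : 𝒵 →L[ℂ] 𝒴} {W : 𝒴 → 𝒵} {B₀ C₄ a₃ a ε₄ : ℝ}
    (h𝔊 : ∀ f, ‖𝔊 f‖ ≤ B₀ * ‖f‖) (hWq : ∀ Y : 𝒴, ‖Y‖ < a₃ → ‖W Y‖ ≤ C₄ * ‖Y‖ ^ 2)
    (hWa : AnalyticOnNhd ℂ W {Y : 𝒴 | ‖Y‖ < a₃}) (hB₀ : 0 ≤ B₀) (hC₄ : 0 ≤ C₄) (ha : 0 < a) (hε₄ : 0 ≤ ε₄)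
    (hdom : 2 * (ε₄ + a) ≤ a₃) (hself : B₀ * C₄ * (ε₄ + a) ^ 2 ≤ ε₄) (hcontr : 4 * B₀ * C₄ * (ε₄ + a) < 1)
    {H₁ : 𝒲 →L[ℂ] 𝒴} {ρ : ℝ} (hρa : ‖H₁‖ * ρ ≤ a) (hlink : ε₄ + a ≤ ε) :
    ∃ (𝒜₁ : 𝒴 → 𝒴) (D : 𝒴 → 𝒳) (𝓗 : 𝒲 → 𝒴),
      (AnalyticOnNhd ℂ 𝒜₁ (ball (0:𝒴) a) ∧ ∀ 𝔄 ∈ ball (0:𝒴) a,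
        ‖𝒜₁ 𝔄‖ ≤ ε₄ ∧ mapT 𝔊 0 W 0 𝔄 (𝒜₁ 𝔄) = 𝒜₁ 𝔄 ∧
        (∀ X' : 𝒴, ‖X'‖ ≤ ε₄ → mapT 𝔊 0 W 0 𝔄 X' = X' → X' = 𝒜₁ 𝔄) ∧ ‖𝒜₁ 𝔄‖ ≤ 4 * B₀ * C₄ * ‖𝔄‖ ^ 2) ∧
      (AnalyticOnNhd ℂ D (ball (0:𝒴) ε) ∧ ∀ A' ∈ ball (0:𝒴) ε,
        D A' ∈ closedBall (0:𝒳) (4 * C₂ * ε ^ 2) ∧ C (A' - H (D A')) = D A' ∧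
        (∀ X' ∈ closedBall (0:𝒳) (4 * C₂ * ε ^ 2), C (A' - H X') = X' → X' = D A') ∧ ‖D A'‖ ≤ 4 * C₂ * ‖A'‖ ^ 2) ∧
      (∀ B, 𝓗 B = (𝒜₁ (H₁ B) + H₁ B) - H (D (𝒜₁ (H₁ B) + H₁ B))) ∧
      AnalyticOnNhd ℂ 𝓗 (ball (0:𝒲) ρ) ∧ 𝓗 0 = 0 ∧ HasFDerivAt 𝓗 H₁ 0 := by
  -- (175): 𝒜₁ from `NE9Prop6SchemeBanach` with Ξ := 𝒴, V := ball 0 a, J := 0, Λ := 0, 𝔄 := id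
  have hΛ : ∀ Y : 𝒴, ‖(0 : 𝒴 →L[ℂ] 𝒴) Y‖ ≤ 0 * ‖Y‖ := fun Y => by simp
  have hself' : B₀ * 0 + 0 * (ε₄ + a) + B₀ * C₄ * (ε₄ + a) ^ 2 ≤ ε₄ := by simpa using hself
  have hcontr' : 0 + 4 * B₀ * C₄ * (ε₄ + a) < 1 := by simpa using hcontr
  obtain ⟨𝒜₁, h𝒜₁a, h𝒜₁⟩ := exists_analyticOnNhd_solution_mapT_of_const (Ξ := 𝒴) (J := fun _ : 𝒴 => (0:𝒵))
    (𝔄 := fun 𝔄 : 𝒴 => 𝔄) (V := ball (0:𝒴) a) isOpen_ball h𝔊 hΛ hWq hWa analyticOnNhd_const analyticOnNhd_id hB₀ hC₄ le_rfl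
    (fun _ _ => by simp) (fun 𝔄 h𝔄 => mem_ball_zero_iff.mp h𝔄) hε₄ hdom hself' hcontr'
  have hsmall : 4 * B₀ * C₄ * ε₄ ≤ 1 := by nlinarith [mul_nonneg (mul_nonneg hB₀ hC₄) ha.le]
  have hdom1 : ε₄ + a ≤ a₃ := by linarith
  have h𝒜₁sq : ∀ 𝔄 ∈ ball (0:𝒴) a, ‖𝒜₁ 𝔄‖ ≤ 4 * B₀ * C₄ * ‖𝔄‖ ^ 2 := fun 𝔄 h𝔄 =>
    norm_le_mul_sq_of_mapT_zero h𝔊 hWq hB₀ hC₄ hdom1 hsmall (mem_ball_zero_iff.mp h𝔄) (h𝒜₁ 𝔄 h𝔄).1 (h𝒜₁ 𝔄 h𝔄).2.1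
  -- (49): D from `NE9Contraction113Banach` §4 with Ξ := 𝒴, V := ball 0 ε, H constant, A := id
  obtain ⟨D, hDa, hD⟩ := analyticOnNhd_fixedPoint_113 (Ξ := 𝒴) (V := ball (0:𝒴) ε) (H := fun _ : 𝒴 => H)
    (A := fun A' : 𝒴 => A') hquad hCa hC₂ hb analyticOnNhd_const analyticOnNhd_id (fun _ _ => hHb)
    (fun A' hA' => mem_ball_zero_iff.mp hA') hq hRC
  -- (174): the composite, written out (`Ap B = 𝒜₁(H₁B) + H₁B`, `𝓗 B = Ap B − H(D(Ap B))`)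
  have hH₁a : ∀ B ∈ ball (0:𝒲) ρ, ‖H₁ B‖ < a := fun B hB => norm_apply_lt_of_opNorm_mul_le ha hρa hB
  have hH₁mem : ∀ B ∈ ball (0:𝒲) ρ, H₁ B ∈ ball (0:𝒴) a := fun B hB => mem_ball_zero_iff.mpr (hH₁a B hB)
  have hApε : ∀ B ∈ ball (0:𝒲) ρ, 𝒜₁ (H₁ B) + H₁ B ∈ ball (0:𝒴) ε := by
    intro B hB
    rw [mem_ball_zero_iff]
    calc ‖𝒜₁ (H₁ B) + H₁ B‖ ≤ ‖𝒜₁ (H₁ B)‖ + ‖H₁ B‖ := norm_add_le _ _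
      _ < ε₄ + a := add_lt_add_of_le_of_lt (h𝒜₁ _ (hH₁mem B hB)).1 (hH₁a B hB)
      _ ≤ ε := hlink
  -- analyticity of the composite on `‖B‖ < ρ`
  have hApa : AnalyticOnNhd ℂ (fun B : 𝒲 => 𝒜₁ (H₁ B) + H₁ B) (ball (0:𝒲) ρ) :=
    (h𝒜₁a.comp (H₁.analyticOnNhd _) hH₁mem).add (H₁.analyticOnNhd _)
  have h𝓗a : AnalyticOnNhd ℂ (fun B : 𝒲 => (𝒜₁ (H₁ B) + H₁ B) - H (D (𝒜₁ (H₁ B) + H₁ B))) (ball (0:𝒲) ρ) :=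
    hApa.sub ((H.analyticOnNhd _).comp (hDa.comp hApa hApε) (mapsTo_univ _ _))
  -- values and derivatives at 0
  have h𝒜₁0 : 𝒜₁ 0 = 0 ∧ HasFDerivAt 𝒜₁ (0 : 𝒴 →L[ℂ] 𝒴) 0 :=
    eq_zero_and_hasFDerivAt_zero_of_norm_le_mul_sq (c := 4 * B₀ * C₄) ha h𝒜₁sq
  have hD0 : D 0 = 0 ∧ HasFDerivAt D (0 : 𝒴 →L[ℂ] 𝒳) 0 :=
    eq_zero_and_hasFDerivAt_zero_of_norm_le_mul_sq (c := 4 * C₂) hε fun A' hA' => (hD A' hA').2.2.2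
  have hAp0 : 𝒜₁ (H₁ 0) + H₁ 0 = 0 := by simp [h𝒜₁0.1]
  have h𝓗0 : (𝒜₁ (H₁ 0) + H₁ 0) - H (D (𝒜₁ (H₁ 0) + H₁ 0)) = 0 := by rw [hAp0, hD0.1, map_zero, sub_zero]
  have hApd : HasFDerivAt (fun B : 𝒲 => 𝒜₁ (H₁ B) + H₁ B) H₁ 0 := by
    have hg : HasFDerivAt 𝒜₁ (0 : 𝒴 →L[ℂ] 𝒴) (H₁ 0) := by rw [map_zero]; exact h𝒜₁0.2
    have h1 : HasFDerivAt (fun B : 𝒲 => 𝒜₁ (H₁ B)) ((0 : 𝒴 →L[ℂ] 𝒴).comp H₁) 0 := hg.comp 0 H₁.hasFDerivAt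
    have h2 := h1.add H₁.hasFDerivAt
    rw [ContinuousLinearMap.zero_comp, zero_add] at h2
    exact h2
  have h𝓗d : HasFDerivAt (fun B : 𝒲 => (𝒜₁ (H₁ B) + H₁ B) - H (D (𝒜₁ (H₁ B) + H₁ B))) H₁ 0 := by
    have hg : HasFDerivAt D (0 : 𝒴 →L[ℂ] 𝒳) (𝒜₁ (H₁ 0) + H₁ 0) := by rw [hAp0]; exact hD0.2
    have h1 : HasFDerivAt (fun B : 𝒲 => D (𝒜₁ (H₁ B) + H₁ B)) ((0 : 𝒴 →L[ℂ] 𝒳).comp H₁) 0 := hg.comp 0 hApd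
    have h2 : HasFDerivAt (fun B : 𝒲 => H (D (𝒜₁ (H₁ B) + H₁ B))) (H.comp ((0 : 𝒴 →L[ℂ] 𝒳).comp H₁)) 0 :=
      H.hasFDerivAt.comp 0 h1
    have h3 := hApd.sub h2
    rw [ContinuousLinearMap.zero_comp, ContinuousLinearMap.comp_zero, sub_zero] at h3
    exact h3
  refine ⟨𝒜₁, D, fun B => (𝒜₁ (H₁ B) + H₁ B) - H (D (𝒜₁ (H₁ B) + H₁ B)),
    ⟨h𝒜₁a, fun 𝔄 h𝔄 => ⟨(h𝒜₁ 𝔄 h𝔄).1, (h𝒜₁ 𝔄 h𝔄).2.1, (h𝒜₁ 𝔄 h𝔄).2.2, h𝒜₁sq 𝔄 h𝔄⟩⟩,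
    ⟨hDa, fun A' hA' => hD A' hA'⟩, fun B => rfl, h𝓗a, h𝓗0, h𝓗d⟩

end Assembly

/-! ## §3 The substrate reading: the assembled chart inhabits `ComplexBackgroundFamily` on the prescribed ball -/

section Substrate

open scoped Matrix Matrix.Norms.L2Operator
open Literature.MathematicalPhysics.QuantumFieldTheory.Balaban1983to89 (Params)
open Literature.MathematicalPhysics.QuantumFieldTheory.Balaban1983to89.B5Prop11Plancherel (Tor fine)
open Literature.MathematicalPhysics.QuantumFieldTheory.Balaban1983to89.B5G183RateUnitTower (lev)
open Summit.QuantumFields.BalabanUV.T4Continuum.SubstrateBackgroundTransporters (unitMod)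
open Summit.QuantumFields.BalabanUV.T4Continuum.SubstrateTransporterSpecies (TowerData)
open Summit.QuantumFields.BalabanUV.T4Continuum.SubstrateTransporterSpeciesHolo (expChartT)
open Summit.QuantumFields.BalabanUV.T4Continuum.SubstrateComplexBackground (ComplexBackgroundFamily)

variable (P : Params) {o : Type*} [Fintype o] [DecidableEq o]
variable {𝒳 𝒵 𝒲 : Type*} [NormedAddCommGroup 𝒳] [NormedSpace ℂ 𝒳] [CompleteSpace 𝒳]
  [NormedAddCommGroup 𝒵] [NormedSpace ℂ 𝒵] [NormedAddCommGroup 𝒲] [NormedSpace ℂ 𝒲]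

/-- [folklore] **THE ASSEMBLED CHART INHABITS THE SUBSTRATE'S D-8 (v) INTERFACE ON THE PRESCRIBED BALL.**  The data of
`exists_sectG_chart` with the chart space `𝒴 := TowerData P o` (the operators `H`, `𝔊`, `H₁` valued there, `C`, `W` defined there)
and a background of record `R0`: then there are `𝓗 : 𝒲 → TowerData P o` and `Fm : ComplexBackgroundFamily P 𝒲 R0 ρ` — ON THE
PRESCRIBED `ρ` of the linking letter `‖H₁‖·ρ ≤ a` ((172)'s role) — with `Fm.uC B = expChartT P R0 (𝓗 B)` (*"U₁ = exp iη𝓗(B)"*, p. 305,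
in the substrate's chart), `𝓗` analytic on `‖B‖ < ρ`, `𝓗 0 = 0`, `HasFDerivAt 𝓗 H₁ 0`, and `𝓗` given by (174) from the solution maps
`𝒜₁` of (175) and `D` of (49) with their uniqueness ∕ a-priori clauses.  (Sibling of `NE9ComplexBackgroundOfContraction.
exists_chartFamily_of_contraction`, which reads ONE contraction's fixed point through the chart; here the chart map is B11's composite.) -/
theorem exists_chartFamily_of_sectG (R0 : TowerData P o) {C : TowerData P o → 𝒳} {C₂ R b ε : ℝ} {H : 𝒳 →L[ℂ] TowerData P o}
    (hquad : ∀ Y : TowerData P o, ‖Y‖ < R → ‖C Y‖ ≤ C₂ * ‖Y‖ ^ 2) (hCa : AnalyticOnNhd ℂ C (ball (0 : TowerData P o) R))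
    (hC₂ : 0 ≤ C₂) (hb : 0 ≤ b) (hHb : ‖H‖ ≤ b) (hε : 0 < ε) (hq : 9 * C₂ * b * ε < 1) (hRC : 3 * ε ≤ R)
    {𝔊 : 𝒵 →L[ℂ] TowerData P o} {W : TowerData P o → 𝒵} {B₀ C₄ a₃ a ε₄ : ℝ}
    (h𝔊 : ∀ f, ‖𝔊 f‖ ≤ B₀ * ‖f‖) (hWq : ∀ Y : TowerData P o, ‖Y‖ < a₃ → ‖W Y‖ ≤ C₄ * ‖Y‖ ^ 2)
    (hWa : AnalyticOnNhd ℂ W {Y : TowerData P o | ‖Y‖ < a₃}) (hB₀ : 0 ≤ B₀) (hC₄ : 0 ≤ C₄) (ha : 0 < a) (hε₄ : 0 ≤ ε₄)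
    (hdom : 2 * (ε₄ + a) ≤ a₃) (hself : B₀ * C₄ * (ε₄ + a) ^ 2 ≤ ε₄) (hcontr : 4 * B₀ * C₄ * (ε₄ + a) < 1)
    {H₁ : 𝒲 →L[ℂ] TowerData P o} {ρ : ℝ} (hρa : ‖H₁‖ * ρ ≤ a) (hlink : ε₄ + a ≤ ε) :
    ∃ (𝓗 : 𝒲 → TowerData P o) (Fm : ComplexBackgroundFamily P 𝒲 R0 ρ),
      (∀ B, Fm.uC B = expChartT P R0 (𝓗 B)) ∧ AnalyticOnNhd ℂ 𝓗 (ball (0:𝒲) ρ) ∧ 𝓗 0 = 0 ∧ HasFDerivAt 𝓗 H₁ 0 ∧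
      ∃ (𝒜₁ : TowerData P o → TowerData P o) (D : TowerData P o → 𝒳),
        (∀ B, 𝓗 B = (𝒜₁ (H₁ B) + H₁ B) - H (D (𝒜₁ (H₁ B) + H₁ B))) ∧
        (∀ 𝔄 ∈ ball (0 : TowerData P o) a, ‖𝒜₁ 𝔄‖ ≤ ε₄ ∧ mapT 𝔊 0 W 0 𝔄 (𝒜₁ 𝔄) = 𝒜₁ 𝔄 ∧
          (∀ X' : TowerData P o, ‖X'‖ ≤ ε₄ → mapT 𝔊 0 W 0 𝔄 X' = X' → X' = 𝒜₁ 𝔄) ∧ ‖𝒜₁ 𝔄‖ ≤ 4 * B₀ * C₄ * ‖𝔄‖ ^ 2) ∧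
        (∀ A' ∈ ball (0 : TowerData P o) ε, D A' ∈ closedBall (0:𝒳) (4 * C₂ * ε ^ 2) ∧ C (A' - H (D A')) = D A' ∧
          (∀ X' ∈ closedBall (0:𝒳) (4 * C₂ * ε ^ 2), C (A' - H X') = X' → X' = D A') ∧ ‖D A'‖ ≤ 4 * C₂ * ‖A'‖ ^ 2) := by
  haveI : CompleteSpace (TowerData P o) := FiniteDimensional.complete ℂ _
  obtain ⟨𝒜₁, D, 𝓗, ⟨-, h𝒜₁⟩, ⟨-, hD⟩, h174, h𝓗a, h𝓗0, h𝓗d⟩ :=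
    exists_sectG_chart hquad hCa hC₂ hb hHb hε hq hRC h𝔊 hWq hWa hB₀ hC₄ ha hε₄ hdom hself hcontr hρa hlink
  have hd : ∀ (k : Fin (P.K + 1)) ν b, DifferentiableOn ℂ (fun B => 𝓗 B k ν b) (ball (0:𝒲) ρ) := fun k ν b =>
    differentiableOn_pi.1 (differentiableOn_pi.1 (differentiableOn_pi.1 h𝓗a.differentiableOn k) ν) b
  exact ⟨𝓗, ComplexBackgroundFamily.ofChart R0 ρ 𝓗 h𝓗0 hd, fun _ => rfl, h𝓗a, h𝓗0, h𝓗d, 𝒜₁, D, h174, h𝒜₁, hD⟩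

end Substrate

end Summit.QuantumFields.BalabanUV.T4Continuum.NE9SectGChartAssembly

end
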